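import Summits.BirchSwinnertonDyer.Rank1Residual.GaloisImage.FrobeniusOrderWitness
import Literature.NumberTheory.EllipticCurves.Kato2004.ThreeAdicFrobeniusCertificate
import Literature.NumberTheory.EllipticCurves.PointCountEulerCriterion
import HarnessLib

/-!
# BSD rank-≤1 residual cell: `3`-ADIC (tower) surjectivity of `ρ_{E,3}` from kernel point counts —
# the Frobenius certificate `ℓ ≡ 2,5 (mod 9)`, `a_ℓ ≡ 3,6 (mod 9)` read off an integer model,
# and the record for `2808j1`

HONEST FRAMING (cell `b2b-bsdres-*`, run/shared/lean/b2b/bsd-rank1-residual/, verbatim): the goal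
of the cell is to DELETE the COMBINATION-SHAPED residual classes for ALL analytic-rank `≤ 1` elliptic
curves over `ℚ` — "full BSD formula for every rank `≤ 1` curve in class C" assembled STRICTLY from
published theorems — so that the rank-`≤ 1` remainder becomes exactly the CONSTRUCTION-SHAPED
classes, which are TYPED (missing-input Props), NOT attempted; this is not "finishing BSD".
Prove what is provable now; shrink each hard class to its core with data; no claim beyond stated
classes. Literature seat `b2b-bsdres-lit-kato` (gen 6). Theorems only (no definition, no named
fact); a TOOL file and ONE per-curve record: nothing here is a class theorem, no label changes,
nothing is booked.

## What this file does

At `p = 3` the integrality hypothesis (12.5.2) of Kato's theorems (Astérisque 295, Thm. 12.5 (4) /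
17.4 (3)) is `∀ n, Surj W (3^n)` (`Kato2004/Condition1252.lean`), and surj(3) does NOT imply it
(Elkies 2006).  The cell feeds the tower at `3` from surj(3) by Wuthrich 2014 Lemma 20 (`9 ∤ N`), by
the (ram)/`j`-witness levers (`JWitnessTowerSurjectivity.lean`), or — on the class-X4 rows at `p = 3`
with neither — so far by census ENGINES only (sha-2 img3adic; additive-p4 gen 13's Frobenius engine).
`Kato2004/ThreeAdicFrobeniusCertificate.lean` (Literature, this seat) proves a KERNEL certificate:
surj(3) + ONE good prime `ℓ` with `ℓ ≡ 2, 5 (mod 9)` and `a_ℓ ≡ 3, 6 (mod 9)` ⟹ the tower.  Here: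

* `forall_hasSurjectiveModNGaloisRep_three_pow_of_intModel_of_frobenius` — the same READ OFF AN
  INTEGER MODEL `integralModelInt W = E₀`: `ℓ ∤ Δ(E₀)` (good reduction), a kernel point count
  `#(E₀ mod ℓ)(𝔽_ℓ) = n_ℓ` (`a_ℓ = ℓ + 1 − n_ℓ`, `frobeniusTrace_eq`), and the two residues
  `ℓ mod 9 ∈ {2, 5}`, `(ℓ + 1 − n_ℓ) mod 9 ∈ {3, 6}` as decidable statements;
  `imageContainsSL2_three_of_intModel_of_frobenius` — hence `Kato2004.ImageContainsSL2 W 3`;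
* the RECORD for Cremona's **`2808j1`** `= [0, 0, 0, −18171, 941814]` (`N = 2808 = 2³·3³·13`,
  Kodaira II* at `3`, potentially good; `j` has its only pole at `13` with `ord₁₃ j = −3`, so no
  (ram)/`j`-witness prime exists at `p = 3` — cell census additive-p4 V21 row `RES-CERT`): surj(3)
  from the kernel point counts `#Ẽ(𝔽₅) = 8`, `#Ẽ(𝔽₁₉) = 24` (`GaloisImage/FrobeniusOrderWitness`:
  `X² + 2X + 5` irreducible mod `3`; `19 ≡ 1`, `a₁₉ = −4 ≡ 2 (mod 3)`, `9 ∤ 24`), and the tower from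
  `#Ẽ(𝔽₂₉) = 27` (`29 ≡ 2 (mod 9)`, `a₂₉ = 3`): `towerSurj3_v2808j1 : ∀ n, Surj W (3^n)` and
  `imageContainsSL2_three_v2808j1`, for any globally minimal `W/ℚ` with this integral model.  This is
  the per-pair input `htow`/`hSL2` of the X4♯(3) assembly (`Additive/X4SharpThreeAssembly.lean`,
  `Additive/X4RankZeroKatoBoundSharp.lean`) on that row, now a kernel theorem instead of an engine
  bit (census: every one of the 3 649 non-exotic surj(3) rows of additive-p4's tables has such a
  witness `ℓ ≤ 479`, cell file `b2b-bsdres-lit-kato/gen6/BETA-WITNESS-v21b.tsv`).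

References: [SerreAbelianLadic1968] Ch. IV §3.4 Lemma 3; [Elkies2006] Introduction, §1;
[Serre1972] §2.4 Prop. 15; [SilvermanAEC2009] VII.1, C.21.3; [Kato2004Asterisque] (12.5.2) p. 222.
-/

noncomputable section

open scoped Classical

open WeierstrassCurve Literature.NumberTheory.EllipticCurves
  Summit.BirchSwinnertonDyer.BirchSwinnertonDyer.Rank1Residual.IntModel

namespace Summit.BirchSwinnertonDyer.Rank1Residual.GaloisImage

/-- **The tower at `3` from surj(3) and ONE Frobenius certificate, READ OFF AN INTEGER MODEL**:
`integralModelInt W = E₀`, a prime `ℓ ∤ Δ(E₀)` with `ℓ ≡ 2, 5 (mod 9)` and a kernel point count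
`#(E₀ mod ℓ)(𝔽_ℓ) = n_ℓ` with `ℓ + 1 − n_ℓ ≡ 3, 6 (mod 9)` give `ρ̄_{W,3^n}` onto for every `n`
(`WeierstrassCurve.forall_hasSurjectiveModNGaloisRep_three_pow_of_frobenius` with
`a_ℓ = ℓ + 1 − n_ℓ`, `frobeniusTrace_eq`). [cite: SerreAbelianLadic1968, Ch. IV §3.4, Lemma 3 (IV-23)]
[cite: Elkies2006, Introduction (p. 1) and §1] -/
theorem forall_hasSurjectiveModNGaloisRep_three_pow_of_intModel_of_frobenius {W : WeierstrassCurve ℚ}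
    [W.IsElliptic] [W.IsGloballyMinimal] {E₀ : WeierstrassCurve ℤ} (hI : integralModelInt W = E₀)
    (h1 : W.HasSurjectiveModNGaloisRep 3) (ℓ : ℕ) [Fact ℓ.Prime] (hΔ : ¬ (ℓ : ℤ) ∣ E₀.Δ) {nℓ : ℕ}
    (hc : Nat.card ((E₀.map (Int.castRingHom (ZMod ℓ))).toAffine.Point) = nℓ)
    (hℓ9 : ℓ % 9 = 2 ∨ ℓ % 9 = 5)
    (ha9 : ((ℓ : ℤ) + 1 - nℓ) % 9 = 3 ∨ ((ℓ : ℤ) + 1 - nℓ) % 9 = 6) (n : ℕ) :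
    W.HasSurjectiveModNGaloisRep (3 ^ n : ℕ) := by
  haveI : Fact (Nat.Prime 3) := ⟨Nat.prime_three⟩
  have hgood : W.HasGoodReductionAtPrime ℓ :=
    hasGoodReductionAtPrime_of_not_dvd W ℓ (by rw [minimalDiscriminantInt_eq hI]; exact hΔ)
  refine forall_hasSurjectiveModNGaloisRep_three_pow_of_frobenius W h1 ℓ hgood hℓ9 ?_ n
  rw [frobeniusTrace_eq hI hc]; exact ha9

/-- **Kato's (12.5.2) at `3` from the integer-model certificate.**
[cite: Kato2004Asterisque, (12.5.2) in Thm. 12.5 (4) (p. 222)] -/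
theorem imageContainsSL2_three_of_intModel_of_frobenius {W : WeierstrassCurve ℚ}
    [W.IsElliptic] [W.IsGloballyMinimal] {E₀ : WeierstrassCurve ℤ} (hI : integralModelInt W = E₀)
    (h1 : W.HasSurjectiveModNGaloisRep 3) (ℓ : ℕ) [Fact ℓ.Prime] (hΔ : ¬ (ℓ : ℤ) ∣ E₀.Δ) {nℓ : ℕ}
    (hc : Nat.card ((E₀.map (Int.castRingHom (ZMod ℓ))).toAffine.Point) = nℓ)
    (hℓ9 : ℓ % 9 = 2 ∨ ℓ % 9 = 5)
    (ha9 : ((ℓ : ℤ) + 1 - nℓ) % 9 = 3 ∨ ((ℓ : ℤ) + 1 - nℓ) % 9 = 6) :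
    haveI : Fact (Nat.Prime 3) := ⟨Nat.prime_three⟩
    Kato2004.ImageContainsSL2 W 3 := by
  haveI : Fact (Nat.Prime 3) := ⟨Nat.prime_three⟩
  exact Kato2004.imageContainsSL2_of_forall_hasSurjectiveModNGaloisRep W 3
    (forall_hasSurjectiveModNGaloisRep_three_pow_of_intModel_of_frobenius hI h1 ℓ hΔ hc hℓ9 ha9)

/-! ### Record: `2808j1` (class X4 at `p = 3`, `r_an = 0`, no (ram)/`j`-witness prime) -/

/-- `#Ẽ(𝔽_5) = 8` for Cremona's model `2808j1 = [0, 0, 0, -18171, 941814]`. [folklore] -/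
theorem card_v2808j1_5 :
    Nat.card (((⟨0, 0, 0, -18171, 941814⟩ : WeierstrassCurve ℤ).map
      (Int.castRingHom (ZMod 5))).toAffine.Point) = 8 := by
  rw [@WeierstrassCurve.natCard_point_eq_one_add_card (ZMod 5) (@ZMod.instField 5 ⟨by norm_num⟩) _ _ _
    (by decide +kernel), @card_sol_eq_sum_euler (ZMod 5) (@ZMod.instField 5 ⟨by norm_num⟩) _ _
    (by rw [ZMod.ringChar_zmod_n]; decide), ZMod.card]
  decide +kernel

/-- `#Ẽ(𝔽_19) = 24` for Cremona's model `2808j1`. [folklore] -/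
theorem card_v2808j1_19 :
    Nat.card (((⟨0, 0, 0, -18171, 941814⟩ : WeierstrassCurve ℤ).map
      (Int.castRingHom (ZMod 19))).toAffine.Point) = 24 := by
  rw [@WeierstrassCurve.natCard_point_eq_one_add_card (ZMod 19) (@ZMod.instField 19 ⟨by norm_num⟩) _ _ _
    (by decide +kernel), @card_sol_eq_sum_euler (ZMod 19) (@ZMod.instField 19 ⟨by norm_num⟩) _ _
    (by rw [ZMod.ringChar_zmod_n]; decide), ZMod.card]
  decide +kernel

/-- `#Ẽ(𝔽_29) = 27` for Cremona's model `2808j1` (`a₂₉ = 3`). [folklore] -/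
theorem card_v2808j1_29 :
    Nat.card (((⟨0, 0, 0, -18171, 941814⟩ : WeierstrassCurve ℤ).map
      (Int.castRingHom (ZMod 29))).toAffine.Point) = 27 := by
  rw [@WeierstrassCurve.natCard_point_eq_one_add_card (ZMod 29) (@ZMod.instField 29 ⟨by norm_num⟩) _ _ _
    (by decide +kernel), @card_sol_eq_sum_euler (ZMod 29) (@ZMod.instField 29 ⟨by norm_num⟩) _ _
    (by rw [ZMod.ringChar_zmod_n]; decide), ZMod.card]
  decide +kernel

/-- **`ρ̄_{E,3}` is onto for `2808j1`**, in the kernel (`GaloisImage/FrobeniusOrderWitness`):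
`ℓ₁ = 5` (`a₅ = −2`: `X² + 2X + 5` has no root mod `3`) and `ℓ₂ = 19` (`19 ≡ 1`, `a₁₉ = −4 ≡ 2
(mod 3)`, `#Ẽ(𝔽₁₉) = 24`, `9 ∤ 24`: a Frobenius of ORDER `3` on `E[3]`), for any globally minimal
elliptic `W/ℚ` with this integral model (census bit surj(3) of the cell's engines: `galrep`, hyp).
[cite: Serre1972, §2.4 Prop. 15] -/
theorem surj3_v2808j1 {W : WeierstrassCurve ℚ} [W.IsElliptic] [W.IsGloballyMinimal]
    (hI : integralModelInt W = ⟨0, 0, 0, -18171, 941814⟩) : W.HasSurjectiveModNGaloisRep 3 :=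
  @hasSurjectiveModNGaloisRep_of_intModel_of_irr_of_order W _ _ _ hI 3 ⟨by norm_num⟩ 5 19 ⟨by norm_num⟩
    ⟨by norm_num⟩ (by norm_num) (by norm_num) (by decide +kernel) (by decide +kernel) _ _
    card_v2808j1_5 card_v2808j1_19 (by decide) (by decide) (by decide) (by decide)

/-- **`ρ̄_{E,3^n}` is onto for every `n`, for `2808j1`** — the `3`-adic tower surjectivity
(= Kato's (12.5.2) at `3`) of a class-X4 row with NO (ram)/`j`-witness prime, in the kernel: surj(3)
(`surj3_v2808j1`) and the Frobenius certificate at `ℓ = 29` (`29 ≡ 2 (mod 9)`, `#Ẽ(𝔽₂₉) = 27`,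
`a₂₉ = 3 ≡ 3 (mod 9)`).  Engines agreeing on this bit: sha-2 img3adic, additive-p4 gen 13
(kit j112466, a different certificate shape), lit-kato gen 6 (`ℓ = 29`).
[cite: SerreAbelianLadic1968, Ch. IV §3.4, Lemma 3 (IV-23)] [cite: Elkies2006, Introduction (p. 1) and §1] -/
theorem towerSurj3_v2808j1 {W : WeierstrassCurve ℚ} [W.IsElliptic] [W.IsGloballyMinimal]
    (hI : integralModelInt W = ⟨0, 0, 0, -18171, 941814⟩) (n : ℕ) :
    W.HasSurjectiveModNGaloisRep (3 ^ n : ℕ) :=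
  @forall_hasSurjectiveModNGaloisRep_three_pow_of_intModel_of_frobenius W _ _ _ hI (surj3_v2808j1 hI)
    29 ⟨by norm_num⟩ (by decide +kernel) _ card_v2808j1_29 (by decide) (by decide) n

/-- **Kato's (12.5.2) for `T_3E`, `E = 2808j1`**, in the kernel.
[cite: Kato2004Asterisque, (12.5.2) in Thm. 12.5 (4) (p. 222)] -/
theorem imageContainsSL2_three_v2808j1 {W : WeierstrassCurve ℚ} [W.IsElliptic] [W.IsGloballyMinimal]
    (hI : integralModelInt W = ⟨0, 0, 0, -18171, 941814⟩) :
    haveI : Fact (Nat.Prime 3) := ⟨Nat.prime_three⟩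
    Kato2004.ImageContainsSL2 W 3 :=
  @imageContainsSL2_three_of_intModel_of_frobenius W _ _ _ hI (surj3_v2808j1 hI) 29 ⟨by norm_num⟩
    (by decide +kernel) _ card_v2808j1_29 (by decide) (by decide)

end Summit.BirchSwinnertonDyer.Rank1Residual.GaloisImage

end
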